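import Summits.Ventures.PercRepro0.DualMap
import Summits.Ventures.PercRepro0.BoundaryParity

/-!
# The column-count potential of the parity lemma, on the lattice through `ψ` (seat p1, gen 1)

Lean twin, on the cell's `Defs.lean`, of the potential `w(f)` of P9-separation-p1-v1 Lemma 2.1 (the PARITY
LEMMA) in the coordinates of the identification `ψ` of P6 §4 (`dualEdge` = `τ` of `DualMap.lean`): the dual
vertex `f = (i+½, j+½)` is the lattice vertex `u = ψ(f) = (j+1, i)`, a dual step is a lattice step `u → u'`, and
the primal edge it crosses is `τ s(u, u')`.

* `W C c h` = the number of horizontal bonds `{(c,y),(c+1,y)}` of `C` with `y < h` — for `u = ψ(f)` this is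
  `w(f) = |{y ≤ j : h(i,y) ∈ C}|` (P9 Lemma 2.1) with `i = u₁`, `j = u₀ − 1`; `pot C u := W C u₁ u₀`;
* `even_step_h`: (★) across a horizontal lattice step (a vertical dual step: P9 case V), unconditionally;
* `even_step_v`: (★) across a vertical lattice step (a horizontal dual step: P9 case H), provided every vertex
  of the half-column `{(u'₁, y) : y < u₀}` has even degree in `C` (the double count `even_bdryCount_iff` of
  `BoundaryParity.lean` over that half-column; P9 needs the whole of `C` even, this local form is what the
  applications use);
* `even_pot_add_crossCount`: telescoping along any lattice walk whose steps all satisfy (★):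
  `pot u + pot v + cr(w, C)` is even, `cr(w, C)` = the number of steps whose crossed bond `τ e` lies in `C`;
* `bdryCount_halfPlane`: the boundary count of the half-plane `{z₀ ≤ m}` is the number of horizontal bonds of
  `C` in the column `m` (the «odd crossing» input of the applications, via `even_bdryCount_iff`).

Imports only landed PercRepro0 modules (which import Mathlib). No instances, no notation, no axioms.
-/

namespace Summit.Ventures.PercRepro0.Potential

open Summit.Ventures.PercRepro0.Defs Summit.Ventures.PercRepro0.Crossing
  Summit.Ventures.PercRepro0.DualMap Summit.Ventures.PercRepro0.EdgeParity
open scoped Classical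

/-! ## Horizontal and vertical bonds -/

/-- The horizontal bond `{(c,y),(c+1,y)}`. -/
def hb (c y : ℤ) : Sym2 (Vertex 2) := s(pt c y, pt (c + 1) y)

/-- The vertical bond `{(c,y),(c,y+1)}`. -/
def vb (c y : ℤ) : Sym2 (Vertex 2) := s(pt c y, pt c (y + 1))

/-- `pt` is injective, iff form. -/
theorem pt_eq_pt {a b c d : ℤ} : pt a b = pt c d ↔ a = c ∧ b = d :=
  ⟨pt_injective2, fun h => by rw [h.1, h.2]⟩

/-- `hb` is injective. -/
theorem hb_inj {c y c' y' : ℤ} : hb c y = hb c' y' ↔ c = c' ∧ y = y' := by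
  simp only [hb, Sym2.eq_iff, pt_eq_pt]
  omega

/-- `vb` is injective. -/
theorem vb_inj {c y c' y' : ℤ} : vb c y = vb c' y' ↔ c = c' ∧ y = y' := by
  simp only [vb, Sym2.eq_iff, pt_eq_pt]
  omega

/-- A horizontal bond is never a vertical bond. -/
theorem hb_eq_vb_iff (c y c' y' : ℤ) : (hb c y = vb c' y') ↔ False := by
  simp only [hb, vb, Sym2.eq_iff, pt_eq_pt, iff_false]
  omega

/-- A vertical bond is never a horizontal bond. -/
theorem vb_eq_hb_iff (c y c' y' : ℤ) : (vb c y = hb c' y') ↔ False := by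
  simp only [hb, vb, Sym2.eq_iff, pt_eq_pt, iff_false]
  omega

/-- A horizontal bond is never a vertical bond. -/
theorem hb_ne_vb (c y c' y' : ℤ) : hb c y ≠ vb c' y' := fun h => (hb_eq_vb_iff c y c' y').1 h

/-- `oneIn` on a horizontal bond. -/
theorem oneIn_hb (S : Set (Vertex 2)) (c y : ℤ) :
    oneIn S (hb c y) ↔ Xor (pt c y ∈ S) (pt (c + 1) y ∈ S) := Iff.rfl

/-- `oneIn` on a vertical bond. -/
theorem oneIn_vb (S : Set (Vertex 2)) (c y : ℤ) :
    oneIn S (vb c y) ↔ Xor (pt c y ∈ S) (pt c (y + 1) ∈ S) := Iff.rfl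

/-- Every bond is a horizontal or a vertical bond. -/
theorem eq_hb_or_vb {e : Sym2 (Vertex 2)} (he : e ∈ bonds 2) :
    ∃ i y : ℤ, e = hb i y ∨ e = vb i y := bond_cases e he

/-- `τ` on a horizontal bond: `hb c y ↦ hb y c`. -/
theorem dualEdge_hb (c y : ℤ) : dualEdge (hb c y) = hb y c := dualEdge_h c y

/-- `τ` on a vertical bond: `vb c y ↦ vb (y+1) (c−1)`. -/
theorem dualEdge_vb (c y : ℤ) : dualEdge (vb c y) = vb (y + 1) (c - 1) := by
  rw [vb, dualEdge_v, vb, sub_add_cancel]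

/-! ## The column count -/

/-- `e` is a horizontal bond of the column `c` at a height `< h`. -/
def colBelow (c h : ℤ) (e : Sym2 (Vertex 2)) : Prop := ∃ y, y < h ∧ e = hb c y

/-- The column count: the number of horizontal bonds of `C` in the column `c` at heights `< h`
(P9 Lemma 2.1's `w(f)` for `f = (c+½, h−½)`). -/
noncomputable def W (C : Finset (Sym2 (Vertex 2))) (c h : ℤ) : ℕ := (C.filter (colBelow c h)).card

/-- Going up one step adds the indicator of the bond at height `h` (P9 case V). -/
theorem W_succ (C : Finset (Sym2 (Vertex 2))) (c h : ℤ) :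
    W C c (h + 1) = W C c h + (if hb c h ∈ C then 1 else 0) := by
  have hsplit : C.filter (colBelow c (h + 1)) =
      C.filter (colBelow c h) ∪ C.filter (fun e => e = hb c h) := by
    rw [← Finset.filter_or]
    refine Finset.filter_congr fun e _ => ?_
    constructor
    · rintro ⟨y, hy, rfl⟩
      rcases lt_or_eq_of_le (Int.lt_add_one_iff.1 hy) with hy' | rfl
      · exact Or.inl ⟨y, hy', rfl⟩
      · exact Or.inr rfl
    · rintro (⟨y, hy, rfl⟩ | rfl)
      · exact ⟨y, by omega, rfl⟩
      · exact ⟨h, by omega, rfl⟩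
  have hdisj : Disjoint (C.filter (colBelow c h)) (C.filter (fun e => e = hb c h)) := by
    rw [Finset.disjoint_left]
    rintro e he he'
    obtain ⟨-, y, hy, rfl⟩ := Finset.mem_filter.1 he
    obtain ⟨-, heq⟩ := Finset.mem_filter.1 he'
    rw [hb_inj] at heq
    omega
  rw [W, W, hsplit, Finset.card_union_of_disjoint hdisj, Finset.filter_eq']
  split_ifs <;> simp

/-- No horizontal bond of `C` below height `h`: the column count vanishes. -/
theorem W_eq_zero (C : Finset (Sym2 (Vertex 2))) (c h : ℤ) (hC : ∀ y, y < h → hb c y ∉ C) :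
    W C c h = 0 := by
  rw [W, Finset.card_eq_zero, Finset.filter_eq_empty_iff]
  rintro e he ⟨y, hy, rfl⟩
  exact hC y hy he

/-! ## (★) across a vertical lattice step: the half-column double count (P9 case H) -/

/-- The half-column `{(c, y) : y < h}` as a vertex set. -/
def halfCol (c h : ℤ) : Set (Vertex 2) := {z | z 0 = c ∧ z 1 < h}

/-- The bonds with exactly one endpoint in the half-column `{(c+1, y) : y < h}` are the horizontal bonds of
the columns `c`, `c+1` below `h` and the vertical bond `{(c+1,h−1),(c+1,h)}` (P9 Lemma 2.1, case H). -/
theorem bdryCount_halfCol (C : Finset (Sym2 (Vertex 2))) (hC : ∀ e ∈ C, e ∈ bonds 2) (c h : ℤ) :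
    bdryCount C (halfCol (c + 1) h) =
      W C c h + W C (c + 1) h + (if vb (c + 1) (h - 1) ∈ C then 1 else 0) := by
  have hsplit : C.filter (oneIn (halfCol (c + 1) h)) =
      (C.filter (colBelow c h) ∪ C.filter (colBelow (c + 1) h)) ∪
        C.filter (fun e => e = vb (c + 1) (h - 1)) := by
    rw [← Finset.filter_or, ← Finset.filter_or]
    refine Finset.filter_congr fun e he => ?_
    obtain ⟨i, y, rfl | rfl⟩ := eq_hb_or_vb (hC e he)
    · simp only [oneIn_hb, halfCol, Set.mem_setOf_eq, pt_zero, pt_one, colBelow, hb_inj, hb_eq_vb_iff, Xor,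
        or_false]
      constructor
      · rintro (⟨⟨h1, h2⟩, h3⟩ | ⟨⟨h1, h2⟩, h3⟩)
        · exact Or.inr ⟨y, h2, by omega, rfl⟩
        · exact Or.inl ⟨y, h2, by omega, rfl⟩
      · rintro (⟨y', hy', h1, h2⟩ | ⟨y', hy', h1, h2⟩)
        · subst h1; subst h2
          exact Or.inr ⟨⟨by omega, hy'⟩, by omega⟩
        · subst h1; subst h2
          exact Or.inl ⟨⟨by omega, hy'⟩, by omega⟩
    · simp only [oneIn_vb, halfCol, Set.mem_setOf_eq, pt_zero, pt_one, colBelow, vb_eq_hb_iff, vb_inj, Xor,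
        and_false, exists_false, false_or]
      constructor
      · rintro (⟨⟨h1, h2⟩, h3⟩ | ⟨⟨h1, h2⟩, h3⟩)
        · exact ⟨h1, by omega⟩
        · exact ⟨h1, by omega⟩
      · rintro ⟨h1, h2⟩
        exact Or.inl ⟨⟨h1, by omega⟩, by omega⟩
  have hd1 : Disjoint (C.filter (colBelow c h)) (C.filter (colBelow (c + 1) h)) := by
    rw [Finset.disjoint_left]
    rintro e he he'
    obtain ⟨-, y, -, rfl⟩ := Finset.mem_filter.1 he
    obtain ⟨-, y', -, heq⟩ := Finset.mem_filter.1 he'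
    rw [hb_inj] at heq
    omega
  have hd2 : Disjoint (C.filter (colBelow c h) ∪ C.filter (colBelow (c + 1) h))
      (C.filter (fun e => e = vb (c + 1) (h - 1))) := by
    rw [Finset.disjoint_left]
    rintro e he he'
    obtain ⟨-, heq⟩ := Finset.mem_filter.1 he'
    rw [Finset.mem_union] at he
    rcases he with he | he <;> obtain ⟨-, y, -, rfl⟩ := Finset.mem_filter.1 he <;>
      exact hb_ne_vb _ _ _ _ heq
  rw [bdryCount, hsplit, Finset.card_union_of_disjoint hd2, Finset.card_union_of_disjoint hd1, W, W,
    Finset.filter_eq']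
  split_ifs <;> simp

/-- (★) across a vertical lattice step `(c, h) → (c, h+1)`... stated on the column counts: if every vertex of
the half-column `{(c+1, y) : y < h}` has even degree in `C`, then `W C c h + W C (c+1) h + [vb (c+1) (h−1) ∈ C]`
is even. -/
theorem even_W_add (C : Finset (Sym2 (Vertex 2))) (hC : ∀ e ∈ C, e ∈ bonds 2) (c h : ℤ)
    (heven : ∀ z : Vertex 2, z 0 = c + 1 → z 1 < h → Even (edeg C z)) :
    Even (W C c h + W C (c + 1) h + (if vb (c + 1) (h - 1) ∈ C then 1 else 0)) := by
  rw [← bdryCount_halfCol C hC c h]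
  rw [even_bdryCount_iff C (fun e he => SimpleGraph.not_isDiag_of_mem_edgeSet _ (hC e he))]
  have : (vertsIn C (halfCol (c + 1) h)).filter (fun z => Odd (edeg C z)) = ∅ := by
    rw [Finset.filter_eq_empty_iff]
    intro z hz hodd
    rw [mem_vertsIn] at hz
    exact (Nat.not_even_iff_odd.2 hodd) (heven z hz.2.1 hz.2.2)
  rw [this, Finset.card_empty]
  exact ⟨0, rfl⟩

/-! ## The potential of a lattice vertex and the two step identities -/

/-- The potential of the lattice vertex `u = ψ(f)`: the column count of the column `u₁` below the height `u₀`
(`= w(f)` of P9 Lemma 2.1). -/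
noncomputable def pot (C : Finset (Sym2 (Vertex 2))) (u : Vertex 2) : ℕ := W C (u 1) (u 0)

/-- (★) across a horizontal lattice step `(a, b) → (a+1, b)` (a vertical dual step, P9 case V):
the crossed bond is `hb b a` and the potential changes by its indicator. -/
theorem even_step_h (C : Finset (Sym2 (Vertex 2))) (a b : ℤ) :
    Even (pot C (pt a b) + pot C (pt (a + 1) b) + (if dualEdge s(pt a b, pt (a + 1) b) ∈ C then 1 else 0)) := by
  have h1 : dualEdge s(pt a b, pt (a + 1) b) = hb b a := dualEdge_h a b
  simp only [pot, pt_zero, pt_one, h1, W_succ]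
  exact ⟨W C b a + (if hb b a ∈ C then 1 else 0), by ring⟩

/-- (★) across a vertical lattice step `(a, b) → (a, b+1)` (a horizontal dual step, P9 case H): the crossed
bond is `vb (b+1) (a−1)`; needs even degrees on the half-column `{(b+1, y) : y < a}`. -/
theorem even_step_v (C : Finset (Sym2 (Vertex 2))) (hC : ∀ e ∈ C, e ∈ bonds 2) (a b : ℤ)
    (heven : ∀ z : Vertex 2, z 0 = b + 1 → z 1 < a → Even (edeg C z)) :
    Even (pot C (pt a b) + pot C (pt a (b + 1)) + (if dualEdge s(pt a b, pt a (b + 1)) ∈ C then 1 else 0)) := by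
  have h1 : dualEdge s(pt a b, pt a (b + 1)) = vb (b + 1) (a - 1) := by
    rw [dualEdge_v, vb, sub_add_cancel]
  simp only [pot, pt_zero, pt_one, h1]
  exact even_W_add C hC b a heven

/-! ## Telescoping along a lattice walk -/

/-- The crossing count of a lattice walk: the number of its steps whose crossed bond `τ e` lies in `C`
(P9 §1: `cr(W, C)`, with multiplicity). -/
noncomputable def crossCount (C : Finset (Sym2 (Vertex 2))) {u v : Vertex 2} (w : (lattice 2).Walk u v) : ℕ :=
  w.edges.countP (fun e => decide (dualEdge e ∈ C))

/-- **Telescoping** (P9 Lemma 2.1, the summation step): if every step `s(x,y)` of the walk satisfies (★), then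
`pot u + pot v + cr(w, C)` is even. -/
theorem even_pot_add_crossCount (C : Finset (Sym2 (Vertex 2))) {u v : Vertex 2} (w : (lattice 2).Walk u v)
    (hstep : ∀ x y : Vertex 2, s(x, y) ∈ w.edges →
      Even (pot C x + pot C y + (if dualEdge s(x, y) ∈ C then 1 else 0))) :
    Even (pot C u + pot C v + crossCount C w) := by
  induction w with
  | nil =>
    simp only [crossCount, SimpleGraph.Walk.edges_nil, List.countP_nil, add_zero]
    exact ⟨pot C _, rfl⟩
  | @cons a b c hab p ih =>
    have hstep' : ∀ x y : Vertex 2, s(x, y) ∈ p.edges →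
        Even (pot C x + pot C y + (if dualEdge s(x, y) ∈ C then 1 else 0)) := by
      intro x y hxy
      exact hstep x y (by rw [SimpleGraph.Walk.edges_cons]; exact List.mem_cons_of_mem _ hxy)
    obtain ⟨k1, hk1⟩ := ih hstep'
    obtain ⟨k2, hk2⟩ := hstep a b (by rw [SimpleGraph.Walk.edges_cons]; exact List.mem_cons_self)
    simp only [crossCount, SimpleGraph.Walk.edges_cons, List.countP_cons, decide_eq_true_eq] at hk1 ⊢
    exact ⟨k1 + k2 - pot C b, by omega⟩

/-! ## The half-plane boundary count -/

/-- The half-plane `{z : z₀ ≤ m}`. -/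
def halfPlane (m : ℤ) : Set (Vertex 2) := {z | z 0 ≤ m}

/-- The bonds of `C` with exactly one endpoint in the half-plane `{z₀ ≤ m}` are its horizontal bonds of the
column `m`: for `C` inside the strip of heights `< h`, the boundary count is `W C m h`. -/
theorem bdryCount_halfPlane (C : Finset (Sym2 (Vertex 2))) (hC : ∀ e ∈ C, e ∈ bonds 2) (m h : ℤ)
    (hh : ∀ y, hb m y ∈ C → y < h) : bdryCount C (halfPlane m) = W C m h := by
  rw [bdryCount, W]
  congr 1
  refine Finset.filter_congr fun e he => ?_
  obtain ⟨i, y, rfl | rfl⟩ := eq_hb_or_vb (hC e he)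
  · simp only [oneIn_hb, halfPlane, Set.mem_setOf_eq, pt_zero, colBelow, hb_inj, Xor]
    constructor
    · rintro (⟨h1, h2⟩ | ⟨h1, h2⟩)
      · have him : i = m := by omega
        subst him
        exact ⟨y, hh y he, rfl, rfl⟩
      · omega
    · rintro ⟨y', hy', rfl, rfl⟩
      exact Or.inl ⟨le_refl _, by omega⟩
  · simp only [oneIn_vb, halfPlane, Set.mem_setOf_eq, pt_zero, colBelow, vb_eq_hb_iff, Xor, and_false,
      exists_false, iff_false, not_or, not_and, not_not]
    exact ⟨fun h => h, fun h => h⟩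

end Summit.Ventures.PercRepro0.Potential
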